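import Summits.BirchSwinnertonDyer.BirchSwinnertonDyer.Theses.ByReductionTypeAtTwo
import Summits.BirchSwinnertonDyer.BirchSwinnertonDyer.Theorems.ByReductionTypeAtTwoOrdKatoOptimalDefs
import Summits.BirchSwinnertonDyer.BirchSwinnertonDyer.Theorems.ByReductionTypeAtTwoAnalyticMuZeroAtTwoHolds
import Literature.NumberTheory.IwasawaTheory.ClassicalMuInvariant
import Literature.NumberTheory.EllipticCurves.DivisionField
import Mathlib.FieldTheory.Finite.GaloisField
import Mathlib.RingTheory.PowerSeries.Basic
import HarnessLib

/-!
# Crux idea `residual-kato-elliptic` — Sketch (crux-ideate g6, ideator 1, stmt-BirchSwinnertonDyer-19573)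

Crux `ByReductionTypeAtTwo.OrdKatoHalfAtTwoIso`; open ∀-residue `OrdKatoHalfDD12ResidueTwo` (Gaussian
stratum: `ρ̄_{E,2}` onto `S₃`, `ℚ(√Δ) = ℚ(i)`).

LEVER (words; the objects are not in the tree): in the mod-2 Iwasawa cohomology
`W := H¹_Iw(ℤ[1/2N𝔣], E[2]) = H¹_Iw(𝒪_{ℚ(i)}[1/2N𝔣], 𝔽₄(χ̄))` (Shapiro, `E[2] ≅ Ind_{ℚ(i)}^ℚ χ̄`), the
reduction `z̄(f_E)` of Kato's zeta element and the Kummer image `c̄` of the Λ-adic elliptic `χ`-unit of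
`ℚ(i)` are COLLINEAR over `Ω = 𝔽₄⟦Γ⟧` (residual CM-ness of Kato's Euler system, the dihedral analogue
of Kim–Kim–Sun Thm 4.10 and of Kato §15 (15.16.1)).  THEOREM `analyticMuZeroAtTwo_holds` gives
`Col⁻(z̄(f_E)) = red(ϖL₂(f_E)) ≠ 0`, so §1 below transfers non-vanishing to `Col⁻(c̄) ≠ 0`, i.e. the
elliptic `χ`-unit is not ≡ (square)·(real unit) at the primes over 2 — the open input «2 ∤ g_E» of the
lines `gaussian-elliptic-units` / `resolvent-cm-mu-two`; Oukhaba's index theorem then gives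
`μ₂(ℚ(E[2])^cyc) = 0` (§3 `TwoDivisionFieldMuVanishes`), and the cards' shared door (MEMO-7 D-S₃ +
Coates–Sujatha 3.4 at 2) gives the residue, hence the crux (§4, kernel-checked composition).

§1 is the first checkable lemma of the line (PROVED): the Λ-currency of the transfer.
§2 records that the mod-2 Iwasawa algebra `𝔽₄⟦T⟧` has no zero divisors (so §1 applies to it).
§3 types the door currency over tree declarations.  §4 composes to the crux BY NAME.
Nothing here proves BSD or the crux; all open inputs are hypotheses.
-/

set_option linter.dupNamespace false
set_option autoImplicit false

noncomputable section

namespace Summit.BirchSwinnertonDyer.BirchSwinnertonDyer.Cruxes.OrdKatoHalfAtTwoIso.ResidualKatoElliptic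

open scoped Classical MatrixGroups ModularForm
open CongruenceSubgroup WeierstrassCurve Literature.NumberTheory.EllipticCurves
  Literature.NumberTheory.EllipticCurves.ModularForms
  Literature.NumberTheory.EllipticCurves.Rank1Residual Literature.NumberTheory.IwasawaTheory
  Summit.BirchSwinnertonDyer.Rank1Residual Summit.BirchSwinnertonDyer.Rank1Residual.X5
  Summit.BirchSwinnertonDyer.BirchSwinnertonDyer.Theorems.OrdKatoIntAtTwo
  Summit.BirchSwinnertonDyer.BirchSwinnertonDyer.Theorems.OrdKatoOptimalAtTwo

/-! ## §1 First lemma (Λ-currency): collinearity transfers non-vanishing of a linear functional -/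

/-- If `a • z = b • c` with `a ≠ 0` in a module over a ring without zero divisors, and a linear
functional `Col` does not vanish on `z`, then it does not vanish on `c` (and a fortiori `b ≠ 0`).
Used with `R = Ω = 𝔽₄⟦Γ⟧`, `M = W = H¹_Iw(ℚ(i)^cyc, 𝔽₄(χ̄))`, `Col = Col⁻ mod 2`,
`z = z̄(f_E)`, `c = c̄_ell`. -/
theorem apply_ne_zero_of_collinear {R M : Type*} [CommRing R] [NoZeroDivisors R]
    [AddCommGroup M] [Module R M] (Col : M →ₗ[R] R) {z c : M} {a b : R}
    (ha : a ≠ 0) (hab : a • z = b • c) (hz : Col z ≠ 0) : Col c ≠ 0 := by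
  intro hc
  have h : a * Col z = b * Col c := by
    rw [← smul_eq_mul, ← smul_eq_mul, ← map_smul, ← map_smul, hab]
  rw [hc, mul_zero] at h
  rcases mul_eq_zero.mp h with h' | h'
  · exact ha h'
  · exact hz h'

/-- Torsion-tolerant form: collinearity modulo an element killed by `Col` (the `Ω`-torsion of `W`,
on which the `Ω`-valued functional `Col⁻` vanishes). -/
theorem apply_ne_zero_of_collinear_mod {R M : Type*} [CommRing R] [NoZeroDivisors R]
    [AddCommGroup M] [Module R M] (Col : M →ₗ[R] R) {z c t : M} {a b : R}
    (ha : a ≠ 0) (hab : a • z = b • c + t) (ht : Col t = 0) (hz : Col z ≠ 0) : Col c ≠ 0 := by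
  intro hc
  have h : a * Col z = b * Col c + Col t := by
    rw [← smul_eq_mul, ← smul_eq_mul, ← map_smul, ← map_smul, hab, map_add]
  rw [hc, mul_zero, ht, add_zero] at h
  rcases mul_eq_zero.mp h with h' | h'
  · exact ha h'
  · exact hz h'

/-- The scalar `b` in a collinearity relation with `Col z ≠ 0` is automatically non-zero. -/
theorem ne_zero_of_collinear {R M : Type*} [CommRing R] [NoZeroDivisors R]
    [AddCommGroup M] [Module R M] (Col : M →ₗ[R] R) {z c : M} {a b : R}
    (ha : a ≠ 0) (hab : a • z = b • c) (hz : Col z ≠ 0) : b ≠ 0 := by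
  rintro rfl
  rw [zero_smul] at hab
  have : a * Col z = 0 := by rw [← smul_eq_mul, ← map_smul, hab, map_zero]
  rcases mul_eq_zero.mp this with h' | h'
  · exact ha h'
  · exact hz h'

/-! ## §2 The mod-2 Iwasawa algebra `Ω = 𝔽₄⟦T⟧` (= `𝒪⟦Γ⟧/2`, `𝒪 = ℤ₂[ζ₃]`) has no zero divisors -/

example : NoZeroDivisors (PowerSeries (GaloisField 2 2)) := inferInstance

example : NoZeroDivisors (PowerSeries (ZMod 2)) := inferInstance

/-! ## §3 Door currency over tree declarations -/

/-- Classical `μ₂ = 0` for the cyclotomic `ℤ₂`-extension of the `2`-division field `ℚ(E[2])`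
(on the residue an `S₃`-sextic containing `ℚ(i)`): the conclusion the lever delivers via Oukhaba's
index theorem, = the heart H1 of cards `gaussian-elliptic-units` / `resolvent-cm-mu-two`. -/
def TwoDivisionFieldMuVanishes (W : WeierstrassCurve ℚ) : Prop :=
  ∀ κ : ZpExtension (W.divisionField 2) 2, κ.IsCyclotomic → ClassicalMuVanishes κ

/-- H1 on the Gaussian residue (what `(WR̄₂)` + `analyticMuZeroAtTwo_holds` + Oukhaba deliver). -/
def GaussianResidueMu : Prop :=
  ∀ (W : WeierstrassCurve ℚ) [W.IsElliptic] [W.IsGloballyMinimal],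
    ¬ W.HasCM → GoodOrd W 2 → W.HasSurjectiveModNGaloisRep 2 → ¬ O1.TwoAdicSurjective W →
    TwoDivisionFieldMuVanishes W

/-- The shared door (MEMO-7 Thm D-S₃ + Coates–Sujatha 2005 Thm 3.4 read at 2; cards 1/2):
classical `μ₂(ℚ(E[2])^cyc) = 0` ⟹ Kato's lower divisibility at 2 for the residue curve. OPEN (memo-grade). -/
def GaussianResidueMuDoor : Prop :=
  ∀ (W : WeierstrassCurve ℚ) [W.IsElliptic] [W.IsGloballyMinimal],
    ¬ W.HasCM → GoodOrd W 2 → W.HasSurjectiveModNGaloisRep 2 → ¬ O1.TwoAdicSurjective W →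
    TwoDivisionFieldMuVanishes W → O1.MainConjectureLowerDivisibilityAtTwoOrd W

/-- The analytic input the lever EXPORTS is a tree theorem (no hypothesis): analytic `μ = 0` at `2`
for every good-ordinary-at-2 curve without a rational `2`-torsion abscissa (⊇ the residue). -/
example : F1Sign2.AnalyticMuZeroAtTwo :=
  Summit.BirchSwinnertonDyer.BirchSwinnertonDyer.Theorems.AnalyticMuTwo.analyticMuZeroAtTwo_holds

/-! ## §4 Composition to the residue and to the crux BY NAME -/

theorem ordKatoHalfDD12ResidueTwo_of_door_of_mu (hdoor : GaussianResidueMuDoor)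
    (hμ : GaussianResidueMu) : OrdKatoHalfDD12ResidueTwo :=
  fun W _ _ hcm hgo hs hns => hdoor W hcm hgo hs hns (hμ W hcm hgo hs hns)

/-- The crux from the route's off-residue binders (B7, B8, Kato's all-primes divisibility at 2) and the
two residue inputs of this line (door, H1).  Kernel-checked composition; every input is a hypothesis. -/
theorem ordKatoHalfAtTwoIso_of_door_of_mu
    (hB7 : KatoMuPartAtOptimalMemberOfNotSurjectiveTwo) (hB8 : KatoIntAtGoodOrdSurjectiveTwo)
    (h17 : ∀ (V : WeierstrassCurve ℚ) [V.IsElliptic] [V.IsGloballyMinimal] [NeZero (V.conductorNorm ℤ)]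
      (f : CuspForm (Gamma0 (V.conductorNorm ℤ)) 2), kato_divisibility_allPrimes V 2 (f := f))
    (hdoor : GaussianResidueMuDoor) (hμ : GaussianResidueMu) :
    Theses.ByReductionTypeAtTwo.OrdKatoHalfAtTwoIso := by
  intro W _ _ hcm _ hgo
  exact exists_isIsogenous_mainConjectureLowerDivisibilityAtTwoOrd_of_binders W hB7 hB8
    (ordKatoHalfDD12ResidueTwo_of_door_of_mu hdoor hμ) h17 hcm hgo

end Summit.BirchSwinnertonDyer.BirchSwinnertonDyer.Cruxes.OrdKatoHalfAtTwoIso.ResidualKatoElliptic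

end
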